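import Summits.FinalStateConjecture.FinalStateConjecture.Theses.PhotonSphereChannels
import Summits.FinalStateConjecture.FinalStateConjecture.Theorems.PhotonSphereChannelsKerrDevDefs
import Literature.Geometry.Lorentzian.StabilityCauchy
import Literature.Geometry.Lorentzian.KillingHorizonShadowAlong
import HarnessLib

/-!
# Crux-ideate gen 1 / round 2 / ideator 5 — first lemmas and target stubs of the two cards
# (crux stmt-FinalStateConjecture-17430 `ChannelsResolveTameDevelopmentsR`, K2R-T2)

Card A `dark-future-exactness`  (the BRIDGE via forward stability + zero scattering data + Cauchy
rigidity): `LateSilentConeIsEmpty` (1+1 Regge–Wheeler shadow, first lemma) and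
`DarkFutureExactnessHull` (the typed bridge stub over `Stability`/`TameHull` vocabulary; a DEVELOPMENT form
`KS-close data on Kerr.slice + MGHD + eternal tame silent end ⇒ Kerr` was typed first and DISCARDED as vacuous:
the MGHD of the partial slice `{t* = 0, r > r₁}` carries no ETERNAL far chart — its past is cut off by the
past Cauchy horizon of the slice's inner edge — so no `EndDatum` on it is `IsTameEnd`).

Card B `channels-to-all-orders` (K1R far half at every apex + eternal boundedness ⇒ Alexakis–Schlue's
"Killing to all orders" at finite regularity ⇒ stationarity near `i⁰` of every dark hull end):
`EternalFarKernelIsStatic` (1+1 shadow, first lemma), `KillingToAllOrdersOfDarkEnds` and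
`FarStationarityOfDarkEnds` (typed target stubs over `TameHull.EndDatum`).

Nothing here is proved; everything must elaborate (sketch file of a crux-ideate seat).
-/

noncomputable section

set_option maxSynthPendingDepth 3
set_option linter.dupNamespace false

open Set Filter Function TopologicalSpace
open scoped Topology Manifold ContDiff ENNReal NNReal

namespace Summit.FinalStateConjecture.FinalStateConjecture.Cruxes.ChannelsResolveTameDevelopmentsR.Ideator5G1

open Literature.Geometry.Lorentzian Literature.Geometry.Lorentzian.ReggeWheeler
open Summit.FinalStateConjecture.FinalStateConjecture.Theses.PhotonSphereChannels
open Summit.FinalStateConjecture.FinalStateConjecture.Theorems.TameHull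

/-! ## Card A — first lemma (1+1 shadow of zero-scattering rigidity) -/

/-- **Late silence empties the forward cone** (1+1 Regge–Wheeler shadow of "zero scattering data
on `𝓗⁺ ∪ 𝓘⁺` to the future of a sphere-cone pair ⇒ nothing there"). For a global `C²` RW solution
of finite energy and an apex `(B, x₀)`: if the energy eventually OUTSIDE the bare forward light cone
`{|x − x₀| > t}` of the time-shifted solution `ψ(B + ·)` is the whole energy (nothing is radiated to
`𝓘⁺` after retarded time `B − x₀` nor into `𝓗⁺` after advanced time `B + x₀`), then `ψ` vanishes
on the closed solid forward cone `{|x − x₀| ≤ t}` of that apex. (Proof sketch: the cone-interior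
energy `K(t) = E − E_ext(t)` is non-decreasing by the landed flux identity
`integral_coneInterior_eq_flux` and `totalEnergy_eq_exteriorEnergy_shift_add`, starts at `0`, and
`liminf (E − K) = E`; so `K ≡ 0`, the energy density vanishes inside, `V > 0` kills `ψ`.)
Complementary to the landed `RW.futureSilentWavesVanish` (silence at EVERY apex ⇒ `ψ ≡ 0`): one apex,
local conclusion. [folklore] -/
def LateSilentConeIsEmpty : Prop :=
  ∀ (M : ℝ), 0 < M → ∀ (r : ℝ → ℝ) (xc : ℝ), IsTortoiseRadius M r xc →
    ∀ (s ℓ : ℕ), s ≤ ℓ → ∀ ψ : ℝ → ℝ → ℝ, IsRWSolution M s ℓ r ψ →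
      totalEnergy (linePotential M s ℓ r) ψ 0 < (⊤ : ℝ≥0∞) →
        ∀ (B x₀ : ℝ),
          channelEnergy (linePotential M s ℓ r) x₀ 0 (fun t x ↦ ψ (B + t) x) atTop =
              totalEnergy (linePotential M s ℓ r) ψ 0 →
            ∀ (t x : ℝ), 0 ≤ t → |x - x₀| ≤ t → ψ (B + t) x = 0

/-! ## Card A — the bridge in HULL form (horizon-penetrating slab closeness + silence ⇒ exact Kerr d.o.c.) -/

section HullForm

variable {𝓢 : Spacetime.{0} 4}

/-- The Kerr–Schild background `(Kerr.region a r₁, g_{M,a}, t*, r)` on the horizon-PENETRATING region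
`{r > r₁}`, `r₁ ∈ (r₋, r₊)` (the domain of the Klainerman–Szeftel slice `Kerr.slice a r₁ = {t* = 0} ∩ {r > r₁}`).
[cite: KlainermanSzeftel2023, §3.1.1] -/
def penetratingBackground (M a r₁ : ℝ) : ModelBackground :=
  ⟨Kerr.region a r₁, Kerr.bilin M a, fun x ↦ x 0, Kerr.radius a⟩

/-- **`r`-weighted `C³` slab closeness of an end to Kerr `(M, a)` across the horizon.** ONE injective smooth
map `Ψ` of the horizon-penetrating region `{r > r₁}` into `𝓢`, covering the domain of outer
communications `E.doc`, future-oriented outside the ergoregion, along which the `r`-WEIGHTED `C³` sup norm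
of `Ψ^* g − g_{M,a}` over the chart SLAB `{|t*| < w}` is `≤ δ` (weight `r`: far quietness at order `1/r`
is built in, so that the induced data on `{t* = 0}` are small in the weighted stability norm; the chart
reaches inside the horizon to `r₁ < r₊`, as the stability theorem requires). The slab, not the whole
exterior: closeness is asked at ONE epoch. [cite: KlainermanSzeftel2023, Thm. 1.2.1] -/
def IsSlabClose (E : EndDatum 𝓢) (M a r₁ w : ℝ) (δ : ℝ≥0∞) : Prop :=
  ∃ Ψ : Kerr.region a r₁ → 𝓢.carrier, Function.Injective Ψ ∧ ContMDiff 𝓘(ℝ, E4) (𝓡 4) ∞ Ψ ∧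
    E.doc ⊆ Set.range Ψ ∧
      supCkENorm {x : E4 | r₁ < Kerr.radius a x ∧ |x 0| < w} 3
          (fun x ↦ Kerr.radius a x • 𝓢.deviationExtend (penetratingBackground M a r₁) Ψ x) ≤ δ ∧
        ∀ x : Kerr.region a r₁, 2 * M < Kerr.radius a x.1 →
          𝓢.timeOrientation.IsFutureDirected (mfderiv 𝓘(ℝ, E4) (𝓡 4) Ψ x (E4.basisVector 0))

/-- **Dark-future exactness, hull form (the bridge as cluster A needs it).** Granted the Klainerman–Szeftel
fact: in every tameness class `(Λ, r₀)`, for `|a| < a₀ M` and `r₁ ∈ (r₋, r₊)` there is `δ > 0` such that an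
eternal `(Λ, r₀)`-tame SILENT end which is `r`-weighted `C³` `δ`-close to Kerr `(M, a)` across the horizon on
ONE unit slab has an exact Kerr domain of outer communications. One-epoch closeness + forward stability +
zero scattering data + backward Cauchy rigidity through the collar; no hypothesis at other epochs.
[cite: KlainermanSzeftel2023, Thm. 1.2.1] -/
def DarkFutureExactnessHull [Kerr.Facts] [Kerr.SliceFacts] : Prop :=
  klainerman_szeftel_kerr_stability_small_a_cauchy →
    ∀ (Λ : ℝ≥0) (r₀ : ℝ), 0 < r₀ → ∃ a₀ > (0 : ℝ), ∀ (M a : ℝ), 0 < M → |a| < a₀ * M →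
      ∀ r₁ ∈ Set.Ioo (Kerr.rMinus M a) (Kerr.rPlus M a), ∃ δ > (0 : ℝ),
        ∀ (𝓢 : Spacetime.{0} 4) (E : EndDatum 𝓢),
          E.IsTameEnd Λ r₀ → E.IsSilent → IsSlabClose E M a r₁ 1 (ENNReal.ofReal δ) →
            ∃ M' a' : ℝ, 0 < M' ∧ |a'| < M' ∧ IsKerrDoc 𝓢 E.doc M' a'

end HullForm

/-! ## Card B — first lemma (1+1 shadow: eternal boundedness kills the kernel) -/

/-- **An eternal bounded field that is a kernel element from every apex is static on the far strip.**
Let `V` be a potential, `xc` a centre, `ρ ≥ 0` an aperture, and `φ : ℝ → ℝ → ℝ` a field such that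
(a) for EVERY apex time `B` the time-shifted field `φ(B + ·, ·)` agrees, on the FAR component
`{x − xc > ρ + |t|}` of the exterior cone, with some element of the non-radiative kernel
`rwKernel V xc ρ` (solutions polynomial in `t` on the cone), and (b) `φ` is bounded on the far strip
`{x > xc + ρ} × ℝ_t`. Then `φ` is static on the far strip: `φ(t, x) = φ(0, x)` for `x > xc + ρ`.
(At fixed far `x` the cone fibres of nearby apexes overlap, so `φ(·, x)` is ONE polynomial in `t` on
all of `ℝ`; bounded polynomials are constant.) This is the step where Alexakis–Schlue use
time-PERIODICITY ("essentially only to rule out linear growth", arXiv:1504.04592 p. 8); eternity +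
tameness of a hull end supplies boundedness instead. [cite: arXiv:1504.04592, Thm. 1.2] -/
def EternalFarKernelIsStatic : Prop :=
  ∀ (V : ℝ → ℝ) (xc ρ : ℝ), 0 ≤ ρ → ∀ φ : ℝ → ℝ → ℝ,
    (∀ B : ℝ, ∃ p ∈ rwKernel V xc ρ, ∀ z ∈ exteriorCone xc ρ, xc < z.2 → φ (B + z.1) z.2 = p z.1 z.2) →
    (∃ C : ℝ, ∀ (t x : ℝ), xc + ρ < x → |φ t x| ≤ C) →
      ∀ (t x : ℝ), xc + ρ < x → φ t x = φ 0 x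

/-! ## Card B — typed target stubs over the hull vocabulary -/

namespace Targets

variable {𝓢 : Spacetime.{0} 4}

/-- **Killing to all orders at infinity for dark tame eternal ends** (Alexakis–Schlue's input, produced
by the log-ball channels instead of periodicity or smoothness of `𝓘`): for every eternal `(Λ, r₀)`-tame
end with positive reference mass which is two-sided non-radiating at order `1/r`
(`EndDatum.IsNonRadiating`), the chart-time derivative of the far deviation decays FASTER THAN ANY
POWER of the radius, uniformly in chart time: `r^N ‖D^m ∂₀ h‖ → 0` for all `N`, `m ≤ 2`. The
antecedent `UniformPhotonSphereChannelsR` (K1R, a theorem of the tree) is the engine: its far one-ended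
form at every apex on the Schwarzschild far background `E.B`, applied to the exact linearised solution
`π = L_T g` (no quadratic error), with the `C log(ℓ+1)` ball turning the uncontrolled high-`ℓ` tail at
radius `r` into an `exp(−c r)` remainder. [cite: arXiv:1504.04592, Prop. 3.5] -/
def KillingToAllOrdersOfDarkEnds : Prop :=
  UniformPhotonSphereChannelsR →
    ∀ (𝓢 : Spacetime.{0} 4) (E : EndDatum 𝓢) (Λ : ℝ≥0) (r₀ : ℝ),
      E.IsTameEnd Λ r₀ → E.IsNonRadiating → 0 < E.M →
        ∀ (N : ℕ), ∀ m ≤ 2, ∀ δ > (0 : ℝ), ∃ R' : ℝ, ∀ x : Kerr.region (0 : ℝ) E.R,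
          R' < Kerr.radius 0 x.1 →
            ‖iteratedFDeriv ℝ m E.hdot x.1‖ * Kerr.radius 0 x.1 ^ N ≤ δ

/-- **Far stationarity of dark tame eternal ends (energy-class Papapetrou near `i⁰`).** Under the same
hypotheses there are an outer radius `R'` and a vector field `K` on `𝓢` which is a Killing field of `g`
on the far-chart image of `{r > R'}` and is timelike future-directed there (Alexakis–Schlue Thm 1.2/1.3
conclusion "stationary near infinity", reached from `KillingToAllOrdersOfDarkEnds` by the
Alexakis–Schlue–Shao / Ionescu–Klainerman Carleman estimate from infinity, which needs positive mass).
[cite: arXiv:1504.04592, Thm. 1.3] -/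
def FarStationarityOfDarkEnds : Prop :=
  UniformPhotonSphereChannelsR →
    ∀ (𝓢 : Spacetime.{0} 4) (E : EndDatum 𝓢) (Λ : ℝ≥0) (r₀ : ℝ),
      E.IsTameEnd Λ r₀ → E.IsNonRadiating → 0 < E.M →
        ∀ [𝓢.metric.HasLeviCivita],
          ∃ (R' : ℝ) (K : Π x : 𝓢.carrier, TangentSpace (𝓡 4) x),
            𝓢.metric.toPseudoRiemannianMetric.IsKillingFieldOn K
                (E.far '' {x | R' < Kerr.radius 0 x.1}) ∧
              ∀ x : Kerr.region (0 : ℝ) E.R, R' < Kerr.radius 0 x.1 →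
                𝓢.metric.IsTimelike (K (E.far x)) ∧
                  𝓢.timeOrientation.IsFutureDirected (K (E.far x))

end Targets

end Summit.FinalStateConjecture.FinalStateConjecture.Cruxes.ChannelsResolveTameDevelopmentsR.Ideator5G1

end
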